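import Summits.HodgeConjecture.CorCM.CommonQuarticCMSubfieldFourfoldsComplete
import HarnessLib

/-!
# The `(4,4)` cell over a common quartic CM subfield: Hodge-conjecture dress and exactness of the reflex criterion

COR-CM (cell `pub-hodgecm2`, binder seat `b16` gen 50, count-neutral claim CM44-COMMONQUARTIC, file F4d; theorems only,
no definition, no named fact, no `sorry`).  NEW as stated, hence under `Summits/`.  HONEST FRAMING: Hodge-conjecture
statements for NAMED classes of CM abelian varieties, unconditional in the kernel; `HC_CM` is neither used nor asserted.

* §1 **`hodgeConjectureFor_prod_of_apply_ne_mul`** — the EXPLICIT additive half on varieties: two CM fourfold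
  realisations over a common quartic CM field `k` with nondegenerate types, one-unsplit-pair data with DIFFERENT pairs,
  and the two ratios `z₁(a)/w₁(a)`, `x₂(b₀)/y(b₁)` outside `F_ℝ = z(k⁺)` ⟹ HC + `B• = D•` on every `A₀^a × A₁^b`.
* §2 `hodgeConjectureFor_of_isIsogenous_prod_fourfolds_of_common_quartic` — the Hodge conjecture for every abelian
  variety ISOGENOUS to such a product (van Geemen's Lemma 3.7).
* §4 `not_isNondegenerateFamily_of_common_galois_quartic`, `exists_exceptional_prod_fourfolds_of_common_galois_quartic`
  — a common GALOIS quartic CM subfield always yields a common place (twist by `Aut k`): no jointly nondegenerate pair,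
  exceptional classes for every two simple non-isogenous CM fourfolds through it (no hypothesis on the types).
* §3 **`exists_smul_eq_conj_iff_isNondegenerateFamily_of_common_quartic`** — EXACTNESS OF THE REFLEX CRITERION in this
  cell: for nondegenerate types, the subgroup of `Aut(ℂ)` generated by the two type stabilisers contains complex
  conjugation (the reflex fields meet in a totally real field, Shimura §8.3 / the tree's `ReflexStabilizersCMHodge`)
  ⟺ the pair is nondegenerate (⟺ no common unsplit place, F4c) — confirming in the kernel the `1952/1952` count of
  the gen-49 numerics (`HOME/pub-hodgecm2-b16/lean-g49/shadow44_reflex.py`).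

## References

* [Gordon1999HodgeAVSurvey] B. B. Gordon, *A survey of the Hodge conjecture for abelian varieties*, §3 Theorem, 7.5–7.7,
  10.10.
* [Shimura1998] G. Shimura, *Abelian Varieties with Complex Multiplication and Modular Functions*, §8.3.
* [vanGeemen1994HodgeAV] B. van Geemen, *An introduction to the Hodge conjecture for abelian varieties*, Lemma 3.7.
-/

set_option autoImplicit false

noncomputable section

open scoped ComplexConjugate
open CategoryTheory CategoryTheory.Limits NumberField NumberField.ComplexEmbedding Module

namespace Summit.HodgeConjecture.CorCM

open Literature.NumberTheory.ComplexMultiplication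
open Literature.AlgebraicGeometry.Motives (AbelianVariety CMType)
open Literature.AlgebraicGeometry.HodgeTheory
open Literature.AlgebraicGeometry.ComplexMultiplication (IsCMTypeRealisation)
open Literature.AlgebraicGeometry.VanGeemen1994 (hodgeClassSpan)
open Literature.AlgebraicGeometry.Pohlmann1968
open Literature.Barriers.HodgeConjecture (divisorClassesSpan)
open OcticOverQuartic

variable {I : Type} {K : I → Type} [∀ i, Field (K i)] [∀ i, NumberField (K i)] [∀ i, IsCMField (K i)] [Fintype I]
  [DecidableEq I] [Nonempty I] {Φ : ∀ i, CMType (K i)}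
variable {A : I → AbelianVariety ℂ} {ι : ∀ i, 𝓞 (K i) →+* End (A i)}
  {θ : ∀ i, K i →+* Module.End ℂ (complexBetti (A i).X 1)}
variable {k : Type} [Field k] [NumberField k] [IsCMField k]

/-! ### §1 The explicit additive half on varieties -/

/-- **HC + `B• = D•` on every `A_{i₀}^a × A_{i₁}^b` by two ratios.**  Realisations of nondegenerate types of octic CM
fields over a common quartic CM field `k`, one-unsplit-pair data with different pairs, `z₁(a)/w₁(a) ∉ F_ℝ` and
`x₂(b₀)/y(b₁) ∉ F_ℝ` — UNCONDITIONAL. [cite: Gordon1999HodgeAVSurvey, §3 Theorem and 10.10] [cite: Shimura1998, §8.3] -/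
theorem hodgeConjectureFor_prod_of_apply_ne_mul {i₀ i₁ : I} (h01 : i₀ ≠ i₁) (hI : ∀ j, j = i₀ ∨ j = i₁)
    (hk : finrank ℚ k = 4) (e₀ : k →+* K i₀) (e₁ : k →+* K i₁) (hd₀ : (A i₀).dim = 4) (hd₁ : (A i₁).dim = 4)
    (hA : ∀ i, IsCMTypeRealisation (Φ i) (A i) (ι i) (θ i)) (hnd : ∀ i, IsNondegenerate (Φ i))
    (τ₀ : K i₀ ≃ₐ[ℚ] K i₀) (hτ1₀ : τ₀ ≠ 1) (hτe₀ : ∀ x : k, τ₀ (e₀ x) = e₀ x) (τ₁ : K i₁ ≃ₐ[ℚ] K i₁)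
    (hτ1₁ : τ₁ ≠ 1) (hτe₁ : ∀ x : k, τ₁ (e₁ x) = e₁ x) {a : k} (ha0 : a ≠ 0) (ha : IsCMField.complexConj k a = -a)
    {b₀ : K i₀} (hb0₀ : b₀ ≠ 0) (hρb₀ : IsCMField.complexConj (K i₀) b₀ = -b₀) (hτb₀ : τ₀ b₀ = -b₀) {b₁ : K i₁}
    (hb0₁ : b₁ ≠ 0) (hρb₁ : IsCMField.complexConj (K i₁) b₁ = -b₁) (hτb₁ : τ₁ b₁ = -b₁) {z₁ z₂ : k →+* ℂ}
    {x₂ : K i₀ →+* ℂ} (hz₁ : ∀ v : K i₀ →+* ℂ, v.comp e₀ = z₁ → v ∈ (Φ i₀).1) (hz₂ : z₂ ≠ z₁)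
    (hz₂' : z₂ ≠ (starRingAut : ℂ ≃+* ℂ) • z₁) (hx₂e : x₂.comp e₀ = z₂) (hx₂Φ : x₂ ∈ (Φ i₀).1)
    (hx₂τ : x₂.comp τ₀.toRingEquiv.toRingHom ∉ (Φ i₀).1) {w₁ w₂ : k →+* ℂ} {y : K i₁ →+* ℂ}
    (hw₁ : ∀ v : K i₁ →+* ℂ, v.comp e₁ = w₁ → v ∈ (Φ i₁).1) (hw₂ : w₂ ≠ w₁)
    (hw₂' : w₂ ≠ (starRingAut : ℂ ≃+* ℂ) • w₁) (hye : y.comp e₁ = w₂) (hyΦ : y ∈ (Φ i₁).1)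
    (hyτ : y.comp τ₁.toRingEquiv.toRingHom ∉ (Φ i₁).1) (hd : w₁ ≠ z₁) (hd' : w₁ ≠ (starRingAut : ℂ ≃+* ℂ) • z₁)
    (h₁ : ∀ f ∈ IntermediateField.normalClosure ℚ (maximalRealSubfield k) ℂ, z₁ a ≠ f * w₁ a)
    (h₄ : ∀ f ∈ IntermediateField.normalClosure ℚ (maximalRealSubfield k) ℂ, x₂ b₀ ≠ f * y b₁) {N : ℕ}
    (π : Fin N → I) :
    HodgeConjectureFor (⨁ fun j : Fin N => A (π j)).dim (⨁ fun j : Fin N => A (π j)).X ∧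
      ∀ m : ℕ, hodgeClassSpan (⨁ fun j : Fin N => A (π j)).dim (⨁ fun j : Fin N => A (π j)).X m =
        divisorClassesSpan (⨁ fun j : Fin N => A (π j)).X (⨁ fun j : Fin N => A (π j)).dim m := by
  have h8₀ : finrank ℚ (K i₀) = 8 := by rw [finrank_eq_two_mul_dim_of_isCMTypeRealisation (hA i₀), hd₀]
  have h8₁ : finrank ℚ (K i₁) = 8 := by rw [finrank_eq_two_mul_dim_of_isCMTypeRealisation (hA i₁), hd₁]
  have h := isNondegenerateFamily_of_apply_ne_mul h01 hI hk e₀ e₁ h8₀ h8₁ hnd τ₀ hτ1₀ hτe₀ τ₁ hτ1₁ hτe₁ ha0 ha hb0₀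
    hρb₀ hτb₀ hb0₁ hρb₁ hτb₁ hz₁ hz₂ hz₂' hx₂e hx₂Φ hx₂τ hw₁ hw₂ hw₂' hye hyΦ hyτ hd hd' h₁ h₄
  exact ⟨h.hodgeConjectureFor_prod hA π, fun m => h.hodgeClassSpan_prod_eq_divisorClassesSpan hA π m⟩

/-! ### §2 Isogeny transport -/

/-- **The Hodge conjecture for every complex abelian variety ISOGENOUS to a product `⨁_{j<N} A_{π j}`** of two CM fourfold
realisations over a common quartic CM field with nondegenerate types and no common unsplit place (van Geemen's Lemma 3.7).
[cite: vanGeemen1994HodgeAV, §3.6–3.7 Lemma 3.7] [cite: Gordon1999HodgeAVSurvey, 10.10] -/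
theorem hodgeConjectureFor_of_isIsogenous_prod_fourfolds_of_common_quartic {i₀ i₁ : I} (h01 : i₀ ≠ i₁)
    (hI : ∀ j, j = i₀ ∨ j = i₁) (hk : finrank ℚ k = 4) (e₀ : k →+* K i₀) (e₁ : k →+* K i₁) (hd₀ : (A i₀).dim = 4)
    (hd₁ : (A i₁).dim = 4) (hA : ∀ i, IsCMTypeRealisation (Φ i) (A i) (ι i) (θ i)) (hnd : ∀ i, IsNondegenerate (Φ i))
    (hno : ¬ ∃ (F : IntermediateField ℚ (K i₀)) (e'' : F →+* K i₁) (u : F →+* ℂ), finrank ℚ F = 4 ∧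
        IsTotallyComplex F ∧
        (∀ y y' : K i₀ →+* ℂ, y.comp (algebraMap F (K i₀)) = u → y'.comp (algebraMap F (K i₀)) = u →
          (y ∈ (Φ i₀).1 ↔ y' ∈ (Φ i₀).1)) ∧
        (∀ y y' : K i₁ →+* ℂ, y.comp e'' = u → y'.comp e'' = u → (y ∈ (Φ i₁).1 ↔ y' ∈ (Φ i₁).1)))
    {N : ℕ} (π : Fin N → I) {B : AbelianVariety ℂ} (hB : AbelianVariety.IsIsogenous B (⨁ fun j : Fin N => A (π j))) :
    HodgeConjectureFor B.dim B.X :=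
  HodgeConjectureFor.of_isIsogenous hB
    (hodgeConjectureFor_prod_fourfolds_of_common_quartic h01 hI hk e₀ e₁ hd₀ hd₁ hA hnd hno π).1

/-! ### §3 Exactness of the reflex criterion -/

/-- **In the `(4,4)` cell over a common quartic CM subfield the reflex criterion is EXACT**: for nondegenerate types,
complex conjugation (on `Hom(K_{i₀}, ℂ)`) lies in the subgroup generated by the two type stabilisers ⟺ the pair is
nondegenerate.  (⟹ is the tree's `ReflexStabilizersCMHodge`; ⟸: by F4c there is no common unsplit place, the two fields of
definition `F_ℝ(z₁(a), x₂(b₀))`, `F_ℝ(w₁(a), y(b₁))` then meet in a real field by F1/F2, and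
`conj_mem_closure_stabilizers_of_fixingFields_inf_real` applies.) [cite: Shimura1998, §8.3]
[cite: Gordon1999HodgeAVSurvey, §3 Theorem (proof)] -/
theorem exists_smul_eq_conj_iff_isNondegenerateFamily_of_common_quartic {i₀ i₁ : I} (h01 : i₀ ≠ i₁)
    (hI : ∀ j, j = i₀ ∨ j = i₁) (hk : finrank ℚ k = 4) (e₀ : k →+* K i₀) (e₁ : k →+* K i₁)
    (h8₀ : finrank ℚ (K i₀) = 8) (h8₁ : finrank ℚ (K i₁) = 8) (hnd : ∀ i, IsNondegenerate (Φ i)) :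
    (∃ g ∈ Subgroup.closure
        ({s : ℂ ≃+* ℂ | ∀ x : K i₀ →+* ℂ, s • x ∈ (Φ i₀).1 ↔ x ∈ (Φ i₀).1} ∪
          {s : ℂ ≃+* ℂ | ∀ y : K i₁ →+* ℂ, s • y ∈ (Φ i₁).1 ↔ y ∈ (Φ i₁).1}),
      ∀ x : K i₀ →+* ℂ, g • x = (starRingAut : ℂ ≃+* ℂ) • x) ↔ CMAlgebra.IsNondegenerateFamily Φ := by
  classical
  refine ⟨fun hg => (isNondegenerateFamily_iff_forall_of_conj_mem_closure_stabilizers h01 hI hg).2 hnd, fun hΦ => ?_⟩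
  have hno := ((isNondegenerateFamily_iff_of_common_quartic h01 hI hk e₀ e₁ h8₀ h8₁).1 hΦ).2
  have h2₀ : finrank ℚ (K i₀) = 2 * finrank ℚ k := by rw [h8₀, hk]
  have h2₁ : finrank ℚ (K i₁) = 2 * finrank ℚ k := by rw [h8₁, hk]
  have hCM₁ := isCMTypeWith_conj (Φ i₁)
  set c : ℂ ≃+* ℂ := starRingAut with hc
  obtain ⟨τ₀, hτ1₀, hτe₀⟩ := exists_algEquiv_over e₀ h2₀
  obtain ⟨τ₁, hτ1₁, hτe₁⟩ := exists_algEquiv_over e₁ h2₁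
  obtain ⟨a, ha0, ha⟩ := exists_antireal (k := k)
  obtain ⟨b₀, hb0₀, hρb₀, hτb₀⟩ := exists_antireal_anti e₀ h2₀ τ₀ hτ1₀ hτe₀
  obtain ⟨b₁, hb0₁, hρb₁, hτb₁⟩ := exists_antireal_anti e₁ h2₁ τ₁ hτ1₁ hτe₁
  obtain ⟨z₁, z₂, x₂, hz₁, hz₂, hz₂', hx₂e, hx₂Φ, hx₂τ⟩ :=
    exists_unsplit_split_of_isNondegenerate hk e₀ h2₀ τ₀ hτ1₀ hτe₀ (Φ i₀) (hnd i₀)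
  obtain ⟨w₁, w₂, y, hw₁, hw₂, hw₂', hye, hyΦ, hyτ⟩ :=
    exists_unsplit_split_of_isNondegenerate hk e₁ h2₁ τ₁ hτ1₁ hτe₁ (Φ i₁) (hnd i₁)
  have hu₀ : ∀ v v' : K i₀ →+* ℂ, v.comp e₀ = z₁ → v'.comp e₀ = z₁ → (v ∈ (Φ i₀).1 ↔ v' ∈ (Φ i₀).1) :=
    fun v v' hv hv' => ⟨fun _ => hz₁ v' hv', fun _ => hz₁ v hv⟩
  -- the pairs are different (else COMMON PLACE)
  have hd : w₁ ≠ z₁ := fun h => hno (exists_commonPlace_of_twist hk e₀ h8₀ τ₀ hτ1₀ hτe₀ hu₀ e₁ fun v v' hv hv' =>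
    ⟨fun _ => hw₁ v' (hv'.trans h.symm), fun _ => hw₁ v (hv.trans h.symm)⟩)
  have hd' : w₁ ≠ c • z₁ := fun h => hno (exists_commonPlace_of_twist hk e₀ h8₀ τ₀ hτ1₀ hτe₀ hu₀ e₁
    fun v v' hv hv' => by
      have hout : ∀ t : K i₁ →+* ℂ, t.comp e₁ = z₁ → t ∉ (Φ i₁).1 := fun t ht htΦ =>
        (hCM₁.rho_smul_mem_iff t).1 (hw₁ _ (by rw [smul_comp_ringHom, ht, h])) htΦ
      exact ⟨fun hv1 => absurd hv1 (hout v hv), fun hv1 => absurd hv1 (hout v' hv')⟩)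
  have hw₁' := eq_or_eq_conj_of_finrank_eq_four hk hz₂ hz₂' w₁ hd hd'
  have hw₂'' : w₂ = z₁ ∨ w₂ = c • z₁ := by
    have h1 : z₁ ≠ w₁ := fun h => hd h.symm
    have h2 : z₁ ≠ c • w₁ := fun h => hd' (by rw [h, conj_smul_conj_smul])
    exact eq_or_eq_conj_of_finrank_eq_four hk h1 h2 w₂ hw₂ hw₂'
  -- the fields of definition and the real-intersection hypothesis
  have hF : ∀ t ∈ IntermediateField.normalClosure ℚ (maximalRealSubfield k) ℂ, conj t = t :=
    fun t ht => conj_apply_of_mem_normalClosure hk ht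
  have hz₂x : ∀ r : k, x₂ (e₀ r) = z₂ r := fun r => by rw [← hx₂e]; rfl
  have hw₂y : ∀ r : k, y (e₁ r) = w₂ r := fun r => by rw [← hye]; rfl
  have hαconj : ∀ z : k →+* ℂ, conj (z a) = -z a := fun z => by
    rw [← IsCMField.complexEmbedding_complexConj k z a, ha, map_neg]
  have hAz : ∀ z : k →+* ℂ, z a * z a ∈ IntermediateField.normalClosure ℚ (maximalRealSubfield k) ℂ := fun z => by
    rw [← map_mul]; exact apply_mem_normalClosure z (by rw [map_mul, ha]; ring)
  obtain ⟨r₀, hr₀, hr₀e⟩ := exists_real_apply_eq_mul_self e₀ h2₀ τ₀ hτ1₀ hτe₀ hρb₀ hτb₀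
  obtain ⟨r₁, hr₁, hr₁e⟩ := exists_real_apply_eq_mul_self e₁ h2₁ τ₁ hτ1₁ hτe₁ hρb₁ hτb₁
  have hB₀ : x₂ b₀ * x₂ b₀ ∈ IntermediateField.normalClosure ℚ (maximalRealSubfield k) ℂ := by
    rw [← map_mul, ← hr₀e, hz₂x]; exact apply_mem_normalClosure z₂ hr₀
  have hB₁ : y b₁ * y b₁ ∈ IntermediateField.normalClosure ℚ (maximalRealSubfield k) ℂ := by
    rw [← map_mul, ← hr₁e, hw₂y]; exact apply_mem_normalClosure w₂ hr₁
  haveI := CMBiquad.finiteDimensional_sup_adjoin (F := IntermediateField.normalClosure ℚ (maximalRealSubfield k) ℂ)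
    (hAz z₁) hB₀
  haveI := CMBiquad.finiteDimensional_sup_adjoin (F := IntermediateField.normalClosure ℚ (maximalRealSubfield k) ℂ)
    (hAz w₁) hB₁
  refine conj_mem_closure_stabilizers_of_fixingFields_inf_real
    (IntermediateField.normalClosure ℚ (maximalRealSubfield k) ℂ ⊔ IntermediateField.adjoin ℚ {z₁ a, x₂ b₀})
    (IntermediateField.normalClosure ℚ (maximalRealSubfield k) ℂ ⊔ IntermediateField.adjoin ℚ {w₁ a, y b₁})
    (forall_smul_mem_iff_of_fix_sup_adjoin fun σ hσF hσα hσβ => forall_smul_mem_iff_of_fix hk e₀ h2₀ τ₀ hτ1₀ hτe₀ ha0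
      ha hb0₀ hρb₀ hτb₀ (Φ i₀) hz₁ hz₂ hz₂' hx₂e hx₂Φ hx₂τ hσF hσα hσβ)
    (forall_smul_mem_iff_of_fix_sup_adjoin fun σ hσF hσα hσβ => forall_smul_mem_iff_of_fix hk e₁ h2₁ τ₁ hτ1₁ hτe₁ ha0
      ha hb0₁ hρb₁ hτb₁ (Φ i₁) hw₁ hw₂ hw₂' hye hyΦ hyτ hσF hσα hσβ)
    (conj_apply_eq_of_ratios hF (hαconj z₁)
      (by rw [← IsCMField.complexEmbedding_complexConj (K i₀) x₂ b₀, hρb₀, map_neg]) (hAz z₁) hB₀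
      (mul_notMem_of_isNondegenerate hk e₀ h2₀ τ₀ hτ1₀ hτe₀ ha0 ha hb0₀ hρb₀ hτb₀ (Φ i₀) (hnd i₀) hz₁ hz₂ hz₂' hx₂e
        hx₂Φ hx₂τ)
      (hαconj w₁) (by rw [← IsCMField.complexEmbedding_complexConj (K i₁) y b₁, hρb₁, map_neg]) (hAz w₁) hB₁
      (mul_notMem_of_isNondegenerate hk e₁ h2₁ τ₁ hτ1₁ hτe₁ ha0 ha hb0₁ hρb₁ hτb₁ (Φ i₁) (hnd i₁) hw₁ hw₂ hw₂' hye
        hyΦ hyτ)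
      ?_ ?_ ?_ ?_)
  · -- `α₀ = f α₁` would give a twist witness
    intro f hf heq
    obtain ⟨r, -, hr⟩ := exists_apply_eq_of_mem_normalClosure hk w₁ hf
    have hrange : ∀ x : k, z₁ x ∈ Set.range w₁ := by
      intro x
      obtain ⟨p, q, hp, hq, rfl⟩ := exists_real_add_real_mul ha0 ha x
      obtain ⟨p', -, hp'⟩ := exists_apply_eq_of_mem_normalClosure hk w₁ (apply_mem_normalClosure z₁ hp)
      obtain ⟨q', -, hq'⟩ := exists_apply_eq_of_mem_normalClosure hk w₁ (apply_mem_normalClosure z₁ hq)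
      refine ⟨p' + q' * (r * a), ?_⟩
      rw [map_add, map_mul, map_mul, hp', hq', hr, ← heq, map_add, map_mul]
    obtain ⟨g, hg⟩ := QuarticCM.exists_algEquiv_comp_eq_of_forall_mem_range hrange
    refine hno (exists_commonPlace_of_twist hk e₀ h8₀ τ₀ hτ1₀ hτe₀ hu₀ (e₁.comp g.toRingEquiv.toRingHom)
      fun v v' hv hv' => ?_)
    have key : ∀ t : K i₁ →+* ℂ, t.comp (e₁.comp g.toRingEquiv.toRingHom) = z₁ → t.comp e₁ = w₁ := by
      intro t ht
      refine RingHom.ext fun x => ?_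
      have h1 := RingHom.congr_fun ht (g.symm x)
      simp only [RingHom.comp_apply] at h1
      rw [hg] at h1
      simp only [RingHom.comp_apply] at h1
      have h2 : g.toRingEquiv.toRingHom (g.symm x) = x := g.apply_symm_apply x
      rw [h2] at h1
      exact h1
    exact ⟨fun _ => hw₁ v' (key v' hv'), fun _ => hw₁ v (key v hv)⟩
  · -- `α₀ = f β₁`: impossible
    intro f hf heq
    obtain ⟨r, -, hr⟩ := exists_apply_eq_of_mem_normalClosure hk w₂ hf
    rcases hw₂'' with h | h
    · refine false_of_apply_eq_mul e₁ τ₁ hτe₁ hτb₁ y ha0 (r := r) ?_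
      rw [hw₂y, hw₂y, hr, h]; exact heq
    · refine false_of_apply_eq_mul e₁ τ₁ hτe₁ hτb₁ y (neg_ne_zero.2 ha0) (r := r) ?_
      rw [hw₂y, hw₂y, hr, map_neg, h, ringEquiv_smul_apply, ← heq]
      change -conj (z₁ a) = z₁ a
      rw [hαconj, neg_neg]
  · -- `β₀ = f α₁`: impossible
    intro f hf heq
    obtain ⟨r, -, hr⟩ := exists_apply_eq_of_mem_normalClosure hk z₂ hf
    rcases hw₁' with h | h
    · refine false_of_apply_eq_apply e₀ τ₀ hτe₀ hb0₀ hτb₀ x₂ (t := r * a) ?_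
      rw [hz₂x, map_mul, heq, ← hr, h]
    · refine false_of_apply_eq_apply e₀ τ₀ hτe₀ hb0₀ hτb₀ x₂ (t := -(r * a)) ?_
      rw [hz₂x, map_neg, map_mul, heq, ← hr, h, ringEquiv_smul_apply]
      change z₂ r * conj (z₂ a) = -(z₂ r * z₂ a)
      rw [hαconj]; ring
  · -- `β₀ = f β₁` would give the second-subfield witness
    intro f hf heq
    exact hno (exists_commonPlace_of_ratio_mem hk ha0 ha e₀ h8₀ τ₀ hτ1₀ hτe₀ hb0₀ hρb₀ hτb₀ hx₂Φ hx₂τ e₁ h8₁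
      τ₁ hτ1₁ hτe₁ hρb₁ hτb₁ hyΦ hyτ hf heq)

/-! ### §4 A common GALOIS quartic CM subfield: always a common place -/

/-- **Two octic CM types over a common GALOIS quartic CM field are never jointly nondegenerate** — `Aut(k)` is transitive
on the places, so the unsplit pair of `Φ_{i₁}` is carried onto that of `Φ_{i₀}` by a twist `e₁ ∘ g`: COMMON PLACE.  (For
nondegenerate members this is the tree's `CommonAbelianCMSubfieldDegenerate`; here no hypothesis on the types.)
[cite: Shimura1998, §8.3 and §18.1] [cite: Gordon1999HodgeAVSurvey, 7.5–7.7] -/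
theorem not_isNondegenerateFamily_of_common_galois_quartic [IsGalois ℚ k] {i₀ i₁ : I} (h01 : i₀ ≠ i₁)
    (hI : ∀ j, j = i₀ ∨ j = i₁) (hk : finrank ℚ k = 4) (e₀ : k →+* K i₀) (e₁ : k →+* K i₁)
    (h8₀ : finrank ℚ (K i₀) = 8) (h8₁ : finrank ℚ (K i₁) = 8) : ¬ CMAlgebra.IsNondegenerateFamily Φ := by
  classical
  intro hΦ
  have hnd := hΦ.isNondegenerate
  have hno := ((isNondegenerateFamily_iff_of_common_quartic h01 hI hk e₀ e₁ h8₀ h8₁).1 hΦ).2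
  have h2₀ : finrank ℚ (K i₀) = 2 * finrank ℚ k := by rw [h8₀, hk]
  have h2₁ : finrank ℚ (K i₁) = 2 * finrank ℚ k := by rw [h8₁, hk]
  obtain ⟨τ₀, hτ1₀, hτe₀⟩ := exists_algEquiv_over e₀ h2₀
  obtain ⟨τ₁, hτ1₁, hτe₁⟩ := exists_algEquiv_over e₁ h2₁
  obtain ⟨z₁, z₂, x₂, hz₁, -, -, -, -, -⟩ :=
    exists_unsplit_split_of_isNondegenerate hk e₀ h2₀ τ₀ hτ1₀ hτe₀ (Φ i₀) (hnd i₀)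
  obtain ⟨w₁, w₂, y, hw₁, -, -, -, -, -⟩ :=
    exists_unsplit_split_of_isNondegenerate hk e₁ h2₁ τ₁ hτ1₁ hτe₁ (Φ i₁) (hnd i₁)
  have hu₀ : ∀ v v' : K i₀ →+* ℂ, v.comp e₀ = z₁ → v'.comp e₀ = z₁ → (v ∈ (Φ i₀).1 ↔ v' ∈ (Φ i₀).1) :=
    fun v v' hv hv' => ⟨fun _ => hz₁ v' hv', fun _ => hz₁ v hv⟩
  -- all places of the normal field `k` have the same image
  have hrange : ∀ x : k, z₁ x ∈ Set.range w₁ := fun x =>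
    normalClosure_le_range_of_normal w₁ (AlgHom.fieldRange_le_normalClosure z₁.toRatAlgHom ⟨x, rfl⟩)
  obtain ⟨g, hg⟩ := QuarticCM.exists_algEquiv_comp_eq_of_forall_mem_range hrange
  refine hno (exists_commonPlace_of_twist hk e₀ h8₀ τ₀ hτ1₀ hτe₀ hu₀ (e₁.comp g.toRingEquiv.toRingHom)
    fun v v' hv hv' => ?_)
  have key : ∀ t : K i₁ →+* ℂ, t.comp (e₁.comp g.toRingEquiv.toRingHom) = z₁ → t.comp e₁ = w₁ := by
    intro t ht
    refine RingHom.ext fun x => ?_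
    have h1 := RingHom.congr_fun ht (g.symm x)
    simp only [RingHom.comp_apply] at h1
    rw [hg] at h1
    simp only [RingHom.comp_apply] at h1
    have h2 : g.toRingEquiv.toRingHom (g.symm x) = x := g.apply_symm_apply x
    rw [h2] at h1
    exact h1
  exact ⟨fun _ => hw₁ v' (key v' hv'), fun _ => hw₁ v (key v hv)⟩

/-- **Two SIMPLE, non-isogenous CM fourfolds whose octic CM fields contain a common GALOIS quartic CM field always carry
an exceptional Hodge class on some `F₀^a × F₁^b`.** [cite: Gordon1999HodgeAVSurvey, 7.4–7.7] -/
theorem exists_exceptional_prod_fourfolds_of_common_galois_quartic [IsGalois ℚ k] {i₀ i₁ : I} (h01 : i₀ ≠ i₁)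
    (hI : ∀ j, j = i₀ ∨ j = i₁) (hk : finrank ℚ k = 4) (e₀ : k →+* K i₀) (e₁ : k →+* K i₁) (hd₀ : (A i₀).dim = 4)
    (hd₁ : (A i₁).dim = 4) (hA : ∀ i, IsCMTypeRealisation (Φ i) (A i) (ι i) (θ i)) (hs : ∀ i, (A i).IsSimple)
    (hniso : ∀ i j, i ≠ j → ¬ AbelianVariety.IsIsogenous (A i) (A j)) :
    ∃ (N : ℕ) (π : Fin N → I) (m : ℕ) (c : complexBetti (⨁ fun j : Fin N => A (π j)).X (2 * m)),
      IsRationalClass c ∧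
      IsOfHodgeType (⨁ fun j : Fin N => A (π j)).dim (⨁ fun j : Fin N => A (π j)).X (2 * m) m m c ∧
      c ∉ divisorClassesSpan (⨁ fun j : Fin N => A (π j)).X (⨁ fun j : Fin N => A (π j)).dim m := by
  have h8₀ : finrank ℚ (K i₀) = 8 := by rw [finrank_eq_two_mul_dim_of_isCMTypeRealisation (hA i₀), hd₀]
  have h8₁ : finrank ℚ (K i₁) = 8 := by rw [finrank_eq_two_mul_dim_of_isCMTypeRealisation (hA i₁), hd₁]
  exact CMAlgebra.exists_exceptional_prod_of_not_isNondegenerateFamily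
    (CMAlgebra.isSeparatingFamily_of_isSimple_of_pairwise_not_isIsogenous hA hs hniso)
    (not_isNondegenerateFamily_of_common_galois_quartic h01 hI hk e₀ e₁ h8₀ h8₁) hA

end Summit.HodgeConjecture.CorCM

end
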